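import Literature.NumberTheory.Transcendental.ExpPointsBranchAtInfinity
import Literature.NumberTheory.Transcendental.ExpPointsLogTypePole
import Literature.NumberTheory.Transcendental.ExpPointsLogFreeUniformize
import Literature.NumberTheory.Transcendental.ExpPointsCuspNormalForm
import Literature.NumberTheory.Transcendental.ExpPointsCuspTranscendence
import Literature.Analysis.Complex.BranchOrders
import HarnessLib

/-!
# The cusp trichotomy for a curve of exponential points (polar first coordinate)

Let `W ⊆ ℂ² × ℂ²` be defined over `ℚ` with `zariskiDim ℂ W < 2`, and suppose an analytic branch
at infinity `𝔟(t) = ((t⁻ᵉ, Φ₁ t / tᴺ), (Φ₂ t / tᴺ, Φ₃ t / tᴺ)) ⊆ W` (`0 < |t| < r`) carries independent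
exponential points `(x, eˣ) = 𝔟(t)` with `t` accumulating at `0`
(`ExpPointsBranchAtInfinity.exists_branch_through_hits`). Then (`cusp_trichotomy`) one of:
(1) the NORMALISED CUSP RAY with transcendental tail carries infinitely many of them (in the
    integer-point form of `ExpPointsCuspNormalForm.infinite_nat_hits`);
(2) a degenerate section `a x₀ + b x₁ = c`, `(a, b) ∈ ℤ² ∖ 0`, carries infinitely many;
(3) a fibre `eˣ = ω` carries infinitely many.
Assembly of: orders/logs of `y` on the branch (`BranchOrders`), the log-type ends
(`ExpPointsLogTypeRegular` → (2), `ExpPointsLogTypePole` → impossible), the log-free ends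
(`ExpPointsLogFreeUniformize`, `ExpPointsCuspNormalForm`) and the algebraic-tail dichotomy
(`ExpPointsCuspTranscendence` → (2) ∨ (3)). The statement is literally the conclusion of the
stub `stub_cuspEscape` of the Schanuel `SparsityTwo` line (with `s = id`). PROVED, no definition.
[folklore]
-/

noncomputable section

open Complex Filter Topology Set Metric Polynomial
open scoped Real

namespace Literature.NumberTheory.Transcendental

open Literature.Analysis.Complex.MeromorphicGerm (frequently_nhdsNE_of_forall_exists)
open Literature.Analysis.Complex.BranchOrders (exists_zpow_exp_form)

/-- The branch point `((t⁻ᵉ, Φ₁ t / tᴺ), (Φ₂ t / tᴺ, Φ₃ t / tᴺ)) ∈ ℂ² × ℂ²` (local notation). -/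
local notation3 "𝔟[" e ", " N ", " Φ₁ ", " Φ₂ ", " Φ₃ ", " t "]" =>
  (Sum.elim ![((t : ℂ) ^ (e : ℕ))⁻¹, (Φ₁ : ℂ → ℂ) t / t ^ (N : ℕ)]
    ![(Φ₂ : ℂ → ℂ) t / t ^ (N : ℕ), (Φ₃ : ℂ → ℂ) t / t ^ (N : ℕ)] : Fin 2 ⊕ Fin 2 → ℂ)

/-- **The cusp trichotomy** (see the module docstring). [folklore] -/
theorem cusp_trichotomy {W : Set (Fin 2 ⊕ Fin 2 → ℂ)} (hW : IsDefinedOver (⊥ : Subfield ℂ) W)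
    (hdim : zariskiDim ℂ W < 2) {e : ℕ} (he : 0 < e) {N : ℕ} {r : ℝ} (hr : 0 < r)
    {Φ₁ Φ₂ Φ₃ : ℂ → ℂ}
    (hana : ∀ t : ℂ, ‖t‖ < r → AnalyticAt ℂ Φ₁ t ∧ AnalyticAt ℂ Φ₂ t ∧ AnalyticAt ℂ Φ₃ t)
    (hWb : ∀ t : ℂ, 0 < ‖t‖ → ‖t‖ < r → 𝔟[e, N, Φ₁, Φ₂, Φ₃, t] ∈ W)
    (hhit : ∀ δ : ℝ, 0 < δ → Set.Infinite {x | x ∈ indepExpPoints W ∧ ∃ t : ℂ, 0 < ‖t‖ ∧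
      ‖t‖ < δ ∧ Sum.elim x (Complex.exp ∘ x) = 𝔟[e, N, Φ₁, Φ₂, Φ₃, t]}) :
    (∃ (s : Fin 2 ≃ Fin 2) (e : ℕ) (A : Polynomial ℂ) (g ℓu ℓv : ℂ → ℂ) (ρ : ℝ),
        let w : ℕ → ℂ := fun N => (((N : ℝ) ^ ((e : ℝ)⁻¹) : ℝ) : ℂ);
        let x : ℕ → Fin 2 → ℂ := fun N =>
          (![2 * ↑π * I * (N : ℂ) + ℓu (w N)⁻¹,
              2 * ↑π * I * (A.eval (w N) + g (w N)⁻¹) + ℓv (w N)⁻¹] : Fin 2 → ℂ) ∘ s;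
        let y : ℕ → Fin 2 → ℂ := fun N =>
          (![Complex.exp (ℓu (w N)⁻¹), Complex.exp (ℓv (w N)⁻¹)] : Fin 2 → ℂ) ∘ s;
        0 < e ∧ 0 < ρ ∧ AnalyticAt ℂ g 0 ∧ g 0 = 0 ∧ AnalyticAt ℂ ℓu 0 ∧ AnalyticAt ℂ ℓv 0 ∧
        (¬ ∃ P : MvPolynomial (Fin 2) ℂ, P ≠ 0 ∧
            ∀ᶠ z in 𝓝 (0 : ℂ), MvPolynomial.eval ![z, g z] P = 0) ∧
        (∀ σ : ℂ, 0 < ‖σ‖ → ‖σ‖ < ρ →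
          Sum.elim ((![2 * ↑π * I * σ⁻¹ ^ e + ℓu σ,
                        2 * ↑π * I * (A.eval σ⁻¹ + g σ) + ℓv σ] : Fin 2 → ℂ) ∘ s)
            ((![Complex.exp (ℓu σ), Complex.exp (ℓv σ)] : Fin 2 → ℂ) ∘ s) ∈ W) ∧
        Set.Infinite {N : ℕ | x N ∈ indepExpPoints W ∧ Complex.exp ∘ x N = y N ∧
          ∃ L : ℤ, A.eval (w N) + g (w N)⁻¹ = L}) ∨
      (∃ a b : ℤ, (a ≠ 0 ∨ b ≠ 0) ∧ ∃ c : ℂ,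
        Set.Infinite {x : Fin 2 → ℂ | x ∈ indepExpPoints W ∧ (a : ℂ) * x 0 + (b : ℂ) * x 1 = c}) ∨
      (∃ ω : Fin 2 → ℂ,
        Set.Infinite {x : Fin 2 → ℂ | x ∈ indepExpPoints W ∧ Complex.exp ∘ x = ω}) := by
  classical
  obtain ⟨hΦ₁, hΦ₂, hΦ₃⟩ := hana 0 (by simpa using hr)
  have hWev : ∀ᶠ t in 𝓝[≠] (0 : ℂ), 𝔟[e, N, Φ₁, Φ₂, Φ₃, t] ∈ W := by
    have hball : ∀ᶠ t in 𝓝[≠] (0 : ℂ), ‖t‖ < r :=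
      eventually_nhdsWithin_of_eventually_nhds
        (eventually_norm_sub_lt 0 hr |>.mono fun t ht => by simpa using ht)
    filter_upwards [hball, self_mem_nhdsWithin] with t ht ht0
    have htne : t ≠ 0 := by rintro rfl; exact ht0 (Set.mem_singleton 0)
    exact hWb t (norm_pos_iff.2 htne) ht
  -- ### orders and logarithms of the multiplicative coordinates
  have hne : ∀ (j : Fin 2) (Φ : ℂ → ℂ), (∀ (x : Fin 2 → ℂ) (t : ℂ),
      Sum.elim x (Complex.exp ∘ x) = 𝔟[e, N, Φ₁, Φ₂, Φ₃, t] → exp (x j) = Φ t / t ^ N) →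
      ∃ᶠ t in 𝓝[≠] (0 : ℂ), Φ t ≠ 0 := by
    intro j Φ hΦ
    refine frequently_nhdsNE_of_forall_exists fun δ hδ => ?_
    obtain ⟨x, hxH, t, ht0, htδ, hpt⟩ := (hhit δ hδ).nonempty
    refine ⟨t, ht0, htδ, fun h0 => ?_⟩
    have := hΦ x t hpt
    rw [h0, zero_div] at this
    exact Complex.exp_ne_zero _ this
  have hne₂ : ∃ᶠ t in 𝓝[≠] (0 : ℂ), Φ₂ t ≠ 0 := hne 0 Φ₂ fun x t hpt => by
    have := congrFun hpt (Sum.inr 0); simpa using this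
  have hne₃ : ∃ᶠ t in 𝓝[≠] (0 : ℂ), Φ₃ t ≠ 0 := hne 1 Φ₃ fun x t hpt => by
    have := congrFun hpt (Sum.inr 1); simpa using this
  obtain ⟨μ₀, -, -, ℓ₀, -, -, hℓ₀, -, -, -, hy₀⟩ := exists_zpow_exp_form hΦ₂ hne₂ N
  obtain ⟨μ₁, -, -, ℓ₁, -, -, hℓ₁, -, -, -, hy₁⟩ := exists_zpow_exp_form hΦ₃ hne₃ N
  -- ### the log-type ends
  by_cases hμ : μ₀ ≠ 0 ∨ μ₁ ≠ 0
  · by_cases hreg : ∃ Φh : ℂ → ℂ, AnalyticAt ℂ Φh 0 ∧ ∀ᶠ t in 𝓝[≠] (0 : ℂ),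
        (μ₁ : ℂ) * ((t ^ e)⁻¹ - ℓ₀ t) - (μ₀ : ℂ) * (Φ₁ t / t ^ N - ℓ₁ t) = Φh t
    · obtain ⟨Φh, hΦh, hregev⟩ := hreg
      exact Or.inr (Or.inl (exists_degenerate_section_of_logType_regular hdim he hΦ₁ hΦ₂ hΦ₃ hWev
        hhit hℓ₀ hℓ₁ hy₀ hy₁ hμ hΦh hregev))
    · exact (false_of_logType_pole hΦ₁ hhit hℓ₀ hℓ₁ hy₀ hy₁ hμ hreg).elim
  -- ### the log-free ends
  · push Not at hμ
    obtain ⟨hμ₀, hμ₁⟩ := hμ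
    subst hμ₀ hμ₁
    simp only [zpow_zero, one_mul] at hy₀ hy₁
    obtain ⟨ε, A, g, ℓu, ℓv, ρ₀, hε, hρ₀, hg, hg0, hℓu, hℓv, hin, hreal⟩ :=
      exists_cusp_form_of_logFree he hΦ₁ hWev hhit hℓ₀ hℓ₁ hy₀ hy₁
    obtain ⟨A', g', ℓu', ℓv', hg', hg'0, hℓu', hℓv', hin', hreal'⟩ :=
      exists_normalised_cusp hW hε hg hg0 hℓu hℓv hin hreal
    by_cases htail : ∃ P : MvPolynomial (Fin 2) ℂ, P ≠ 0 ∧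
        ∀ᶠ z in 𝓝 (0 : ℂ), MvPolynomial.eval ![z, g' z] P = 0
    · exact Or.inr (classical_class_of_algebraic_tail hdim he hρ₀ hg' hℓu' hℓv' hin' hreal' htail)
    · refine Or.inl ⟨Equiv.refl _, e, A', g', ℓu', ℓv', ρ₀, ?_⟩
      intro w x y
      refine ⟨he, hρ₀, hg', hg'0, hℓu', hℓv', htail, fun σ hσ0 hσρ => ?_, ?_⟩
      · simpa only [Equiv.coe_refl, Function.comp_id] using hin' σ hσ0 hσρ
      · have := infinite_nat_hits (W := W) he hreal'
        simpa only [x, y, w, Equiv.coe_refl, Function.comp_id] using this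

end Literature.NumberTheory.Transcendental

end
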